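import Literature.MathematicalPhysics.QuantumFieldTheory.Balaban1983to89.B15Prop1LocalLettersModel
import Literature.MathematicalPhysics.QuantumFieldTheory.Balaban1983to89.B15Prop1CarrierOnSU2BoxExt193

/-!
# `Balaban1983to89.B15Prop1LocalLettersSU2Box` — [Balaban1989LargeFieldI] Prop. 1 p. 194 / [Balaban1989LargeFieldII] pp. 358–359: THE N12∕s1
# CHAIN RE-THREADED WITH LOCAL LETTERS, LAYERS 2–4 — `SU(2)`, parallelepipeds, the `x₁`-axial `G₀`, the slice coordinates, (m1) from the
# (1.7) letter, the p. 193 extension pinned — every per-`V_k` datum letter asked only at REGULAR `V_k` (`Rg i Vk`), `hA`∕`hc3` only on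
# the ball `‖B′‖ ≤ r`

statement-level skeleton of published theorems with citation tags; proofs where landed; nothing here is a claim about
the Yang–Mills mass gap

Cell pub-ymgap, HUMAN RULING D-0062 (Track A full width), seat `pub-ymgap-dag-n12-c` (R134 acceleration seat (a), strategy s1 of DAG node
N12 = [B15]; generation g4, seventh product; SELF-AUDIT TS-LETTERS-GLOBAL, pub-ymgap INBOX 2026-08-27 ≈04:09Z — see the header of
`B15Prop1LocalLettersModel` for the located point and the shape of the repair).

WHAT THIS FILE PROVES (no `sorry`, no definition, no `… : Prop` fact; axioms standard): the localized twins of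
`B15Prop1CarrierOnSU2Box.prop1Printed_lfVarOn_su2_box` ∕ `…_slice` (p467897 ∕ p470158), `B15Prop1CarrierOnSU2BoxIneq19.
prop1Printed_lfVarOn_su2_box_G0_of_17` (p473804) and `B15Prop1CarrierOnSU2BoxExt193.prop1Printed_lfVarOn_su2_box_G0_of_17_ext193` (p480805):
★ `prop1Printed_lfVarOn_su2_box_local`, ★ `prop1Printed_lfVarOn_su2_box_slice_local`, ★ `prop1Printed_lfVarOn_su2_box_G0_of_17_local`,
★ `prop1Printed_lfVarOn_su2_box_G0_of_17_ext193_local` — statements of the originals with the abstract regularity predicate `Rg`, its bridge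
`hRg` to the carrier's `Regular` below `eR i`, the per-`V_k` letters `hpos`∕`h17`, `hH`, `hHst`, `hdV0`, `hdV` premised on `Rg i Vk`, and
`hA`∕`hc3` premised on `Rg i Vk` and `‖X‖ ≤ r i`; proofs verbatim otherwise (BY NAME: `rep_x1_box`, `coord_ι1/2/3`, `ineq19_slice_of_17`,
`extend_mem_extSet`, `dist1_plaqHol_extend_shellGauge_le`).

HONEST SCOPE.  Count-neutral; NOT a discharge of N12; nothing of Proposition 1 asserted beyond the displayed letters; nothing continuum ∕ OS ∕
mass-gap ∕ Clay.
-/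

noncomputable section

open Set Finset
open scoped RealInnerProductSpace Real

namespace Literature.MathematicalPhysics.QuantumFieldTheory.Balaban1983to89.B15Prop1LocalLettersSU2Box

open B15DeterminingSets GaugeField B16Sect1Backgrounds B15Prop1Carrier B8Eq17ClassAkV1
open B15Prop1GaugeFixing B15Prop1CarrierOnFromModel B15Prop1CarrierOnFromLetters B15Prop1LocalLettersModel
open B15Prop1CarrierOnSU2Box B15Prop1SliceIneq18 B15Prop1CarrierOnSU2BoxIneq19 B15Prop1CarrierOnSU2BoxExt193
open T4CubeChartGnomonic (SU2)
open B15Prop1ChartSU2 (su2Chart iexp_ilog norm_ilog_le dist1_iexp_le isCriticalPt_gaugeAct_su2)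
open B15Prop1RelativeAxialGauge (exists_isGaugeOn_relSmall)
open B15Prop1SliceCoordinates (GaugeSlice ιA freeBonds coord_ι1 coord_ι2 coord_ι3)
open T4AxialGaugeSmallField (castSite boxPlaqs)
open B7Prop1Explicit (e e_apply)
open B6BondElimination (unitVec unitVec_apply)
open B6TreeGaugePoincare (curl)
open B16Eq18Proof (box mem_box)
open B15Extension193 (extend)
open B15ShellGauge193 (shellGauge)
open B15ShellGauge193Local (extend_mem_extSet dist1_plaqHol_extend_shellGauge_le)

variable {P : Params}

/-- `↑(box (hi − lo + 1) lo) = [lo, hi]` (private plumbing, as in `B15Prop1CarrierOnSU2BoxIneq19`). [folklore] -/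
private theorem box_toNat_coe (lo hi : Fin P.d → ℤ) :
    (↑(box (fun i => (hi i - lo i + 1).toNat) lo) : Set (Fin P.d → ℤ)) = Set.Icc lo hi := by
  ext x
  simp only [Finset.mem_coe, mem_box, Set.mem_Icc]
  constructor
  · intro h
    refine ⟨fun i => (h i).1, fun i => ?_⟩
    have h2 := (h i).2
    have : ((hi i - lo i + 1).toNat : ℤ) ≤ max (hi i - lo i + 1) 0 := by
      rw [Int.toNat_eq_max]
    have hm : max (hi i - lo i + 1) 0 = hi i - lo i + 1 ∨ max (hi i - lo i + 1) 0 = 0 := max_choice _ _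
    rcases hm with hm | hm <;> rw [hm] at this <;> linarith [(h i).1]
  · rintro ⟨h1, h2⟩ i
    refine ⟨h1 i, ?_⟩
    have : (hi i - lo i + 1).toNat = hi i - lo i + 1 := Int.toNat_of_nonneg (by linarith [h1 i, h2 i])
    rw [this]
    linarith [h2 i]

/-! ## §1 Layer 2: `SU(2)`, boxes, `x₁`-axial `G₀` (local) -/

/-- **LOCAL twin of `B15Prop1CarrierOnSU2Box.prop1Printed_lfVarOn_su2_box`** (per-`V_k` letters at regular `V_k`, `hA`∕`hc3` on the ball).
[cite: Balaban1989LargeFieldI, Prop. 1 (1.77)–(1.78) p.194; Balaban1989LargeFieldII, pp.358–359, (1.9), (1.12)–(1.13); Balaban1985Variational, Prop. 4 p.293] -/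
theorem prop1Printed_lfVarOn_su2_box_local (hd : 2 ≤ P.d) {ι : Type} (I : ι → InstOn P SU2)
    (Rg : ∀ i, GaugeField P (I i).k SU2 → Prop)
    [∀ i, DecidableEq (PBond P (I i).k)]
    {E F : ι → Type*}
    [∀ i, NormedAddCommGroup (E i)] [∀ i, InnerProductSpace ℝ (E i)] [∀ i, FiniteDimensional ℝ (E i)]
    [∀ i, NormedAddCommGroup (F i)] [∀ i, InnerProductSpace ℝ (F i)]
    (P₀ : ∀ i, E i →ₗ[ℝ] E i) (hP2 : ∀ i x, P₀ i (P₀ i x) = P₀ i x) (hPsa : ∀ i (x y : E i), ⟪P₀ i x, y⟫ = ⟪x, P₀ i y⟫)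
    (H : ∀ i, GaugeField P (I i).k SU2 → (E i →ₗ[ℝ] F i)) (Hst : ∀ i, GaugeField P (I i).k SU2 → (F i →ₗ[ℝ] E i))
    (hadj : ∀ i Vk (x : E i) (y : F i), ⟪H i Vk x, y⟫ = ⟪x, Hst i Vk y⟫)
    (Δ₁ : ∀ i, GaugeField P (I i).k SU2 → (F i →ₗ[ℝ] F i)) (dV : ∀ i, GaugeField P (I i).k SU2 → F i → F i)
    (J : ∀ i, GaugeField P (I i).k SU2 → F i)
    -- the geometry of the instances: boxes on the torus, inside `Z`, with the `x₁`-axial tree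
    (lo hi : ι → Fin P.d → ℤ) (n : ι → ℕ) (hn : ∀ i κ, hi i κ ≤ lo i κ + n i) (hN : ∀ i, n i + 2 < P.sitesPerDir (I i).k)
    (hbox : ∀ i, pts (I i).k (I i).Λ = (castSite '' Set.Icc (lo i) (hi i) : Set (Site P (I i).k)))
    (hZ : ∀ i, (boxPlaqs (lo i - 1) (hi i + 1) : Set (Plaq P (I i).k)) ⊆ plaqsInside (pts (I i).k (I i).Z))
    (μ₀ : Fin P.d) (hμ₀ : (μ₀ : ℕ) = 0)
    (T : ∀ i, Finset (PBond P (I i).k))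
    (hT : ∀ i, ∀ b ∈ T i, ∃ x, x ∈ Set.Icc (lo i) (hi i) ∧ b = ⟨castSite (x - e μ₀), μ₀⟩)
    (ext : ∀ i, GaugeField P (I i).k SU2 → GaugeField P (I i).k SU2)
    (ιA : ∀ i, E i →ₗ[ℝ] VecField P (I i).k (EuclideanSpace ℝ (Fin 3)))
    {γ h₁ hst cJ bx : ℝ} (hγ : 0 < γ) (hh₁ : 0 ≤ h₁) (hhst : 0 ≤ hst) (hcJ : 0 ≤ cJ) (hbx : 0 ≤ bx)
    {ℓ ρ r eA eD a₁ δc N eR : ι → ℝ} (hℓ : ∀ i, 0 ≤ ℓ i) (hr : ∀ i, 0 < r i) (heA : ∀ i, 0 < eA i) (heD : ∀ i, 0 < eD i)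
    (heR : ∀ i, 0 < eR i) (hRg : ∀ i ε Vk, 0 < ε → ε ≤ eR i → (lfVarOn su2Chart I).Regular i ε Vk → Rg i Vk)
    (hδc : ∀ i, 0 < δc i) (ha₁ : ∀ i, 0 ≤ a₁ i) (hM : ∀ i, 1 ≤ (I i).M)
    -- model letters
    (hpos : ∀ i Vk, Rg i Vk → ∀ x, P₀ i x = x → γ / (I i).M ^ 5 * ‖x‖ ^ 2 ≤ ⟪H i Vk x, Δ₁ i Vk (H i Vk x)⟫)
    (hH : ∀ i Vk, Rg i Vk → ∀ x, ‖H i Vk x‖ ≤ h₁ * ‖x‖) (hHst : ∀ i Vk, Rg i Vk → ∀ z, ‖Hst i Vk z‖ ≤ hst * ‖z‖)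
    (hdV0 : ∀ i Vk, Rg i Vk → dV i Vk 0 = 0)
    (hdV : ∀ i Vk, Rg i Vk → ∀ u v : F i, ‖u‖ ≤ ρ i → ‖v‖ ≤ ρ i → ‖dV i Vk u - dV i Vk v‖ ≤ ℓ i * ‖u - v‖)
    (hρ : ∀ i, h₁ * r i ≤ ρ i) (hsmall : ∀ i, (I i).M ^ 5 / γ * hst * ℓ i * h₁ ≤ 1 / 2)
    (hA : ∀ i Vk, Rg i Vk → ∀ X δ : E i, ‖X‖ ≤ r i →
      HasDerivAt (fun s : ℝ => (I i).f (expMul su2Chart (ιA i (X + s • δ)) (ext i Vk)))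
      (⟪δ, Hst i Vk (J i Vk)⟫ + ⟪δ, Hst i Vk (Δ₁ i Vk (H i Vk X))⟫ + ⟪δ, Hst i Vk (dV i Vk (H i Vk X))⟫) 0)
    (hJ : ∀ i ε Vk, 0 < ε → (lfVarOn su2Chart I).Regular i ε Vk → ‖J i Vk‖ ≤ cJ * ε)
    (hc3 : ∀ i Vk, Rg i Vk → ∀ B : E i, P₀ i B = B → ‖B‖ ≤ r i →
      (IsCriticalPt su2Chart (bondsOf (pts (I i).k (I i).Λ)) (I i).f (expMul su2Chart (ιA i B) (ext i Vk)) ↔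
        ∀ δB : E i, P₀ i δB = δB →
          ⟪δB, Hst i Vk (J i Vk)⟫ + ⟪δB, Hst i Vk (Δ₁ i Vk (H i Vk B))⟫ + ⟪δB, Hst i Vk (dV i Vk (H i Vk B))⟫ = 0))
    (hc3'' : ∀ i (u : GaugeTransf P (I i).k SU2) (V : GaugeField P (I i).k SU2), IsGaugeOn (pts (I i).k (I i).Λ) u →
      (I i).f (gaugeAct u V) = (I i).f V)
    (hAn : ∀ i ε Vk, 0 < ε → ε ≤ eA i → (lfVarOn su2Chart I).Regular i ε Vk → (I i).An ε Vk)
    (hdom : ∀ i, (I i).dom = domReg (I i).Z (I i).k (a₁ i))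
    (hext0 : ∀ i Vk, ext i Vk ∈ extSet (bondsOf (pts (I i).k (I i).Λ)) Vk)
    (hextZ : ∀ i ε Vk, 0 < ε → ε ≤ eD i → (lfVarOn su2Chart I).Regular i ε Vk →
      ∀ p ∈ plaqsInside (pts (I i).k (I i).Z), dist1 (plaqHol (ext i Vk) p) ≤ bx * (I i).M ^ 2 * ε)
    (hextΛ : ∀ i ε Vk, 0 < ε → (lfVarOn su2Chart I).Regular i ε Vk →
      ∀ p ∈ plaqsOf (pts (I i).k (I i).Λ), dist1 (plaqHol (ext i Vk) p) ≤ bx * (I i).M ^ 2 * ε)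
    (hι1 : ∀ i (B : E i), P₀ i B = B → IsSupportedOn {b | b ∈ bondsOf (pts (I i).k (I i).Λ) ∧ b ∉ T i} (ιA i B))
    (hι2 : ∀ i (A : VecField P (I i).k (EuclideanSpace ℝ (Fin 3))) (t : ℝ),
      IsSupportedOn {b | b ∈ bondsOf (pts (I i).k (I i).Λ) ∧ b ∉ T i} A →
      (∀ b, ‖A b‖ ≤ t) → ∃ B : E i, P₀ i B = B ∧ ιA i B = A ∧ ‖B‖ ≤ N i * t)
    (hι3 : ∀ i (B : E i) (b : PBond P (I i).k), ‖ιA i B b‖ ≤ ‖B‖)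
    -- thresholds
    (hN' : ∀ i, N i * (π / 2 * δc i) ≤ r i)
    (hδ : ∀ i ε, 0 < ε → ε ≤ eD i →
      ((n i : ℝ) + 2) * ((n i : ℝ) + P.d) * (a₁ i + (bx * (I i).M ^ 2 * ε + ε)) < δc i)
    (he1 : ∀ i ε, 0 < ε → ε ≤ eD i → (4 * 1 * (2 * (I i).M ^ 5 * hst * cJ / γ) + bx * (I i).M ^ 2) * ε < a₁ i) :
    B15.Prop1Printed (lfVarOn su2Chart I) := by
  refine prop1Printed_lfVarOn_of_letters_local su2Chart I Rg P₀ hP2 hPsa H Hst hadj Δ₁ dV J T ext ιA hγ hh₁ hhst hcJ hbx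
    (κ := 1) zero_le_one (Cℓ := π / 2) (by positivity) hℓ hr heA heD heR hRg hδc hM hpos hH hHst hdV0 hdV hρ hsmall hA hJ hc3
    (fun i u V hu hV => isCriticalPt_gaugeAct_su2 (fun u' hu' V' => hc3'' i u' V' hu') hu hV) hc3'' hAn hdom hext0 hextZ
    hextΛ (fun i g _ => iexp_ilog g) (fun i g _ => norm_ilog_le g) (fun X => by simpa using dist1_iexp_le X) hι1 hι2 hι3
    ?_ hN' he1
  -- hrep at the `x₁`-axial `G₀` from the relative axial gauge (lit-balaban-type-B15)
  intro i ε Vk V hε hεD hreg hV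
  have hε' : 0 ≤ bx * (I i).M ^ 2 * ε + ε := by positivity
  have hVtZ : PlaqSmallOn (plaqsInside (pts (I i).k (I i).Z)) (bx * (I i).M ^ 2 * ε + ε) (ext i Vk) :=
    fun p hp => (hextZ i ε Vk hε hεD hreg p hp).trans_lt (by linarith)
  rw [hdom i] at hV
  exact rep_x1_box hd (hn i) (hN i) (hbox i) (hZ i) hμ₀ (hT i) (hext0 i Vk) (ha₁ i) hε' hVtZ hV (hδ i ε hε hεD)

/-- **LOCAL twin of `B15Prop1CarrierOnSU2Box.prop1Printed_lfVarOn_su2_box_slice`** (`E i := GaugeSlice`, `P₀ = id`).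
[cite: Balaban1989LargeFieldI, Prop. 1 (1.77)–(1.78) p.194; Balaban1989LargeFieldII, pp.358–359, (1.9), (1.12)–(1.13); Balaban1985Variational, Prop. 4 p.293] -/
theorem prop1Printed_lfVarOn_su2_box_slice_local (hd : 2 ≤ P.d) {ι : Type} (I : ι → InstOn P SU2)
    (Rg : ∀ i, GaugeField P (I i).k SU2 → Prop)
    [∀ i, DecidableEq (PBond P (I i).k)]
    (T : ∀ i, Finset (PBond P (I i).k))
    {F : ι → Type*} [∀ i, NormedAddCommGroup (F i)] [∀ i, InnerProductSpace ℝ (F i)]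
    (H : ∀ i, GaugeField P (I i).k SU2 →
      (GaugeSlice (pts (I i).k (I i).Λ) (T i) (EuclideanSpace ℝ (Fin 3)) →ₗ[ℝ] F i))
    (Hst : ∀ i, GaugeField P (I i).k SU2 →
      (F i →ₗ[ℝ] GaugeSlice (pts (I i).k (I i).Λ) (T i) (EuclideanSpace ℝ (Fin 3))))
    (hadj : ∀ i Vk (x : GaugeSlice (pts (I i).k (I i).Λ) (T i) (EuclideanSpace ℝ (Fin 3))) (y : F i),
      ⟪H i Vk x, y⟫ = ⟪x, Hst i Vk y⟫)
    (Δ₁ : ∀ i, GaugeField P (I i).k SU2 → (F i →ₗ[ℝ] F i)) (dV : ∀ i, GaugeField P (I i).k SU2 → F i → F i)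
    (J : ∀ i, GaugeField P (I i).k SU2 → F i)
    (lo hi : ι → Fin P.d → ℤ) (n : ι → ℕ) (hn : ∀ i κ, hi i κ ≤ lo i κ + n i) (hN : ∀ i, n i + 2 < P.sitesPerDir (I i).k)
    (hbox : ∀ i, pts (I i).k (I i).Λ = (castSite '' Set.Icc (lo i) (hi i) : Set (Site P (I i).k)))
    (hZ : ∀ i, (boxPlaqs (lo i - 1) (hi i + 1) : Set (Plaq P (I i).k)) ⊆ plaqsInside (pts (I i).k (I i).Z))
    (μ₀ : Fin P.d) (hμ₀ : (μ₀ : ℕ) = 0)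
    (hT : ∀ i, ∀ b ∈ T i, ∃ x, x ∈ Set.Icc (lo i) (hi i) ∧ b = ⟨castSite (x - e μ₀), μ₀⟩)
    (ext : ∀ i, GaugeField P (I i).k SU2 → GaugeField P (I i).k SU2)
    {γ h₁ hst cJ bx : ℝ} (hγ : 0 < γ) (hh₁ : 0 ≤ h₁) (hhst : 0 ≤ hst) (hcJ : 0 ≤ cJ) (hbx : 0 ≤ bx)
    {ℓ ρ r eA eD a₁ δc eR : ι → ℝ} (hℓ : ∀ i, 0 ≤ ℓ i) (hr : ∀ i, 0 < r i) (heA : ∀ i, 0 < eA i) (heD : ∀ i, 0 < eD i)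
    (heR : ∀ i, 0 < eR i) (hRg : ∀ i ε Vk, 0 < ε → ε ≤ eR i → (lfVarOn su2Chart I).Regular i ε Vk → Rg i Vk)
    (hδc : ∀ i, 0 < δc i) (ha₁ : ∀ i, 0 ≤ a₁ i) (hM : ∀ i, 1 ≤ (I i).M)
    (hpos : ∀ i Vk, Rg i Vk → ∀ x : GaugeSlice (pts (I i).k (I i).Λ) (T i) (EuclideanSpace ℝ (Fin 3)),
      γ / (I i).M ^ 5 * ‖x‖ ^ 2 ≤ ⟪H i Vk x, Δ₁ i Vk (H i Vk x)⟫)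
    (hH : ∀ i Vk, Rg i Vk → ∀ x, ‖H i Vk x‖ ≤ h₁ * ‖x‖) (hHst : ∀ i Vk, Rg i Vk → ∀ z, ‖Hst i Vk z‖ ≤ hst * ‖z‖)
    (hdV0 : ∀ i Vk, Rg i Vk → dV i Vk 0 = 0)
    (hdV : ∀ i Vk, Rg i Vk → ∀ u v : F i, ‖u‖ ≤ ρ i → ‖v‖ ≤ ρ i → ‖dV i Vk u - dV i Vk v‖ ≤ ℓ i * ‖u - v‖)
    (hρ : ∀ i, h₁ * r i ≤ ρ i) (hsmall : ∀ i, (I i).M ^ 5 / γ * hst * ℓ i * h₁ ≤ 1 / 2)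
    (hA : ∀ i Vk, Rg i Vk → ∀ X δ : GaugeSlice (pts (I i).k (I i).Λ) (T i) (EuclideanSpace ℝ (Fin 3)), ‖X‖ ≤ r i →
      HasDerivAt (fun s : ℝ => (I i).f (expMul su2Chart (ιA (pts (I i).k (I i).Λ) (T i) (X + s • δ)) (ext i Vk)))
      (⟪δ, Hst i Vk (J i Vk)⟫ + ⟪δ, Hst i Vk (Δ₁ i Vk (H i Vk X))⟫ + ⟪δ, Hst i Vk (dV i Vk (H i Vk X))⟫) 0)
    (hJ : ∀ i ε Vk, 0 < ε → (lfVarOn su2Chart I).Regular i ε Vk → ‖J i Vk‖ ≤ cJ * ε)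
    (hc3 : ∀ i Vk, Rg i Vk → ∀ B : GaugeSlice (pts (I i).k (I i).Λ) (T i) (EuclideanSpace ℝ (Fin 3)), ‖B‖ ≤ r i →
      (IsCriticalPt su2Chart (bondsOf (pts (I i).k (I i).Λ)) (I i).f
          (expMul su2Chart (ιA (pts (I i).k (I i).Λ) (T i) B) (ext i Vk)) ↔
        ∀ δB : GaugeSlice (pts (I i).k (I i).Λ) (T i) (EuclideanSpace ℝ (Fin 3)),
          ⟪δB, Hst i Vk (J i Vk)⟫ + ⟪δB, Hst i Vk (Δ₁ i Vk (H i Vk B))⟫ + ⟪δB, Hst i Vk (dV i Vk (H i Vk B))⟫ = 0))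
    (hc3'' : ∀ i (u : GaugeTransf P (I i).k SU2) (V : GaugeField P (I i).k SU2), IsGaugeOn (pts (I i).k (I i).Λ) u →
      (I i).f (gaugeAct u V) = (I i).f V)
    (hAn : ∀ i ε Vk, 0 < ε → ε ≤ eA i → (lfVarOn su2Chart I).Regular i ε Vk → (I i).An ε Vk)
    (hdom : ∀ i, (I i).dom = domReg (I i).Z (I i).k (a₁ i))
    (hext0 : ∀ i Vk, ext i Vk ∈ extSet (bondsOf (pts (I i).k (I i).Λ)) Vk)
    (hextZ : ∀ i ε Vk, 0 < ε → ε ≤ eD i → (lfVarOn su2Chart I).Regular i ε Vk →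
      ∀ p ∈ plaqsInside (pts (I i).k (I i).Z), dist1 (plaqHol (ext i Vk) p) ≤ bx * (I i).M ^ 2 * ε)
    (hextΛ : ∀ i ε Vk, 0 < ε → (lfVarOn su2Chart I).Regular i ε Vk →
      ∀ p ∈ plaqsOf (pts (I i).k (I i).Λ), dist1 (plaqHol (ext i Vk) p) ≤ bx * (I i).M ^ 2 * ε)
    -- thresholds (`N i = √|free bonds|`)
    (hN' : ∀ i, Real.sqrt (freeBonds (pts (I i).k (I i).Λ) (T i)).card * (π / 2 * δc i) ≤ r i)
    (hδ : ∀ i ε, 0 < ε → ε ≤ eD i →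
      ((n i : ℝ) + 2) * ((n i : ℝ) + P.d) * (a₁ i + (bx * (I i).M ^ 2 * ε + ε)) < δc i)
    (he1 : ∀ i ε, 0 < ε → ε ≤ eD i → (4 * 1 * (2 * (I i).M ^ 5 * hst * cJ / γ) + bx * (I i).M ^ 2) * ε < a₁ i) :
    B15.Prop1Printed (lfVarOn su2Chart I) :=
  prop1Printed_lfVarOn_su2_box_local hd I Rg (E := fun i => GaugeSlice (pts (I i).k (I i).Λ) (T i) (EuclideanSpace ℝ (Fin 3)))
    (fun _ => LinearMap.id) (fun _ _ => rfl) (fun _ _ _ => rfl) H Hst hadj Δ₁ dV J lo hi n hn hN hbox hZ μ₀ hμ₀ T hT ext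
    (fun i => ιA (pts (I i).k (I i).Λ) (T i)) hγ hh₁ hhst hcJ hbx hℓ hr heA heD heR hRg hδc ha₁ hM
    (fun i Vk hR x _ => hpos i Vk hR x) hH hHst hdV0 hdV hρ hsmall hA hJ
    (fun i Vk hR B _ hBr => (hc3 i Vk hR B hBr).trans ⟨fun h δB _ => h δB, fun h δB => h δB rfl⟩) hc3'' hAn hdom
    hext0 hextZ hextΛ (fun _ => coord_ι1 _ _) (fun _ => coord_ι2 _ _) (fun _ => coord_ι3 _ _) hN' hδ he1

/-! ## §2 Layer 3: (m1) from the (1.7) letter (local) -/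

/-- **LOCAL twin of `B15Prop1CarrierOnSU2BoxIneq19.prop1Printed_lfVarOn_su2_box_G0_of_17`** (`h17` asked at regular `V_k`).
[cite: Balaban1989LargeFieldI, Prop. 1 (1.77)–(1.78) p.194; Balaban1989LargeFieldII, (1.7)–(1.9) p.358, pp.358–359; Balaban1985Variational, Prop. 4 p.293] -/
theorem prop1Printed_lfVarOn_su2_box_G0_of_17_local (hd : 2 ≤ P.d) (h0 : 0 < P.d) {ι : Type} (I : ι → InstOn P SU2)
    (Rg : ∀ i, GaugeField P (I i).k SU2 → Prop)
    [∀ i, DecidableEq (PBond P (I i).k)]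
    (T : ∀ i, Finset (PBond P (I i).k))
    {F : ι → Type*} [∀ i, NormedAddCommGroup (F i)] [∀ i, InnerProductSpace ℝ (F i)]
    (H : ∀ i, GaugeField P (I i).k SU2 →
      (GaugeSlice (pts (I i).k (I i).Λ) (T i) (EuclideanSpace ℝ (Fin 3)) →ₗ[ℝ] F i))
    (Hst : ∀ i, GaugeField P (I i).k SU2 →
      (F i →ₗ[ℝ] GaugeSlice (pts (I i).k (I i).Λ) (T i) (EuclideanSpace ℝ (Fin 3))))
    (hadj : ∀ i Vk (x : GaugeSlice (pts (I i).k (I i).Λ) (T i) (EuclideanSpace ℝ (Fin 3))) (y : F i),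
      ⟪H i Vk x, y⟫ = ⟪x, Hst i Vk y⟫)
    (Δ₁ : ∀ i, GaugeField P (I i).k SU2 → (F i →ₗ[ℝ] F i)) (dV : ∀ i, GaugeField P (I i).k SU2 → F i → F i)
    (J : ∀ i, GaugeField P (I i).k SU2 → F i)
    (lo hi : ι → Fin P.d → ℤ) (n : ι → ℕ) (hn : ∀ i κ, hi i κ ≤ lo i κ + n i) (hN : ∀ i, n i + 2 < P.sitesPerDir (I i).k)
    (hbox : ∀ i, pts (I i).k (I i).Λ = (castSite '' Set.Icc (lo i) (hi i) : Set (Site P (I i).k)))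
    (hZ : ∀ i, (boxPlaqs (lo i - 1) (hi i + 1) : Set (Plaq P (I i).k)) ⊆ plaqsInside (pts (I i).k (I i).Z))
    (hTG0 : ∀ i, T i = (box (fun κ => (hi i κ - lo i κ + 1).toNat) (lo i)).image fun x =>
      (⟨castSite (x - unitVec ⟨0, h0⟩), ⟨0, h0⟩⟩ : PBond P (I i).k))
    (hN5 : ∀ i κ, ((hi i κ - lo i κ + 1).toNat : ℤ) + 5 < P.sitesPerDir (I i).k)
    (K : ι → ℕ) (hK1 : ∀ i, 1 ≤ K i) (hKn : ∀ i κ, (hi i κ - lo i κ + 1).toNat ≤ K i)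
    (ext : ∀ i, GaugeField P (I i).k SU2 → GaugeField P (I i).k SU2)
    {γ γ₀ h₁ hst cJ bx : ℝ} (hγ : 0 < γ) (hγ₀ : 0 ≤ γ₀) (hh₁ : 0 ≤ h₁) (hhst : 0 ≤ hst) (hcJ : 0 ≤ cJ) (hbx : 0 ≤ bx)
    {ℓ ρ r eA eD a₁ δc Cerr eR : ι → ℝ} (hℓ : ∀ i, 0 ≤ ℓ i) (hr : ∀ i, 0 < r i) (heA : ∀ i, 0 < eA i) (heD : ∀ i, 0 < eD i)
    (heR : ∀ i, 0 < eR i) (hRg : ∀ i ε Vk, 0 < ε → ε ≤ eR i → (lfVarOn su2Chart I).Regular i ε Vk → Rg i Vk)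
    (hδc : ∀ i, 0 < δc i) (ha₁ : ∀ i, 0 ≤ a₁ i) (hM : ∀ i, 1 ≤ (I i).M)
    -- (m1) REPLACED by the (1.7) letter, the smallness and the constant bookkeeping
    (h17 : ∀ i Vk, Rg i Vk → ∀ X : GaugeSlice (pts (I i).k (I i).Λ) (T i) (EuclideanSpace ℝ (Fin 3)),
      γ₀ * (∑ z ∈ box (fun κ => (hi i κ - lo i κ + 1).toNat + 3) (fun κ => lo i κ - 2), ∑ μ : Fin P.d, ∑ a : Fin 3,
          curl (fun b => ιA (pts (I i).k (I i).Λ) (T i) X (⟨castSite b.1, b.2⟩ : PBond P (I i).k) a) z ⟨0, h0⟩ μ ^ 2) -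
        Cerr i * ‖X‖ ^ 2 ≤ ⟪H i Vk X, Δ₁ i Vk (H i Vk X)⟫)
    (hsm : ∀ i, Cerr i ≤ γ₀ / (2 * (3 * (K i : ℝ) ^ 2 + 2 * (K i : ℝ) ^ 4)))
    (hγle : ∀ i, γ / (I i).M ^ 5 ≤ γ₀ / (2 * (3 * (K i : ℝ) ^ 2 + 2 * (K i : ℝ) ^ 4)))
    (hH : ∀ i Vk, Rg i Vk → ∀ x, ‖H i Vk x‖ ≤ h₁ * ‖x‖) (hHst : ∀ i Vk, Rg i Vk → ∀ z, ‖Hst i Vk z‖ ≤ hst * ‖z‖)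
    (hdV0 : ∀ i Vk, Rg i Vk → dV i Vk 0 = 0)
    (hdV : ∀ i Vk, Rg i Vk → ∀ u v : F i, ‖u‖ ≤ ρ i → ‖v‖ ≤ ρ i → ‖dV i Vk u - dV i Vk v‖ ≤ ℓ i * ‖u - v‖)
    (hρ : ∀ i, h₁ * r i ≤ ρ i) (hsmall : ∀ i, (I i).M ^ 5 / γ * hst * ℓ i * h₁ ≤ 1 / 2)
    (hA : ∀ i Vk, Rg i Vk → ∀ X δ : GaugeSlice (pts (I i).k (I i).Λ) (T i) (EuclideanSpace ℝ (Fin 3)), ‖X‖ ≤ r i →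
      HasDerivAt (fun s : ℝ => (I i).f (expMul su2Chart (ιA (pts (I i).k (I i).Λ) (T i) (X + s • δ)) (ext i Vk)))
      (⟪δ, Hst i Vk (J i Vk)⟫ + ⟪δ, Hst i Vk (Δ₁ i Vk (H i Vk X))⟫ + ⟪δ, Hst i Vk (dV i Vk (H i Vk X))⟫) 0)
    (hJ : ∀ i ε Vk, 0 < ε → (lfVarOn su2Chart I).Regular i ε Vk → ‖J i Vk‖ ≤ cJ * ε)
    (hc3 : ∀ i Vk, Rg i Vk → ∀ B : GaugeSlice (pts (I i).k (I i).Λ) (T i) (EuclideanSpace ℝ (Fin 3)), ‖B‖ ≤ r i →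
      (IsCriticalPt su2Chart (bondsOf (pts (I i).k (I i).Λ)) (I i).f
          (expMul su2Chart (ιA (pts (I i).k (I i).Λ) (T i) B) (ext i Vk)) ↔
        ∀ δB : GaugeSlice (pts (I i).k (I i).Λ) (T i) (EuclideanSpace ℝ (Fin 3)),
          ⟪δB, Hst i Vk (J i Vk)⟫ + ⟪δB, Hst i Vk (Δ₁ i Vk (H i Vk B))⟫ + ⟪δB, Hst i Vk (dV i Vk (H i Vk B))⟫ = 0))
    (hc3'' : ∀ i (u : GaugeTransf P (I i).k SU2) (V : GaugeField P (I i).k SU2), IsGaugeOn (pts (I i).k (I i).Λ) u →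
      (I i).f (gaugeAct u V) = (I i).f V)
    (hAn : ∀ i ε Vk, 0 < ε → ε ≤ eA i → (lfVarOn su2Chart I).Regular i ε Vk → (I i).An ε Vk)
    (hdom : ∀ i, (I i).dom = domReg (I i).Z (I i).k (a₁ i))
    (hext0 : ∀ i Vk, ext i Vk ∈ extSet (bondsOf (pts (I i).k (I i).Λ)) Vk)
    (hextZ : ∀ i ε Vk, 0 < ε → ε ≤ eD i → (lfVarOn su2Chart I).Regular i ε Vk →
      ∀ p ∈ plaqsInside (pts (I i).k (I i).Z), dist1 (plaqHol (ext i Vk) p) ≤ bx * (I i).M ^ 2 * ε)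
    (hextΛ : ∀ i ε Vk, 0 < ε → (lfVarOn su2Chart I).Regular i ε Vk →
      ∀ p ∈ plaqsOf (pts (I i).k (I i).Λ), dist1 (plaqHol (ext i Vk) p) ≤ bx * (I i).M ^ 2 * ε)
    -- thresholds (`N i = √|free bonds|`)
    (hN' : ∀ i, Real.sqrt (freeBonds (pts (I i).k (I i).Λ) (T i)).card * (π / 2 * δc i) ≤ r i)
    (hδ : ∀ i ε, 0 < ε → ε ≤ eD i →
      ((n i : ℝ) + 2) * ((n i : ℝ) + P.d) * (a₁ i + (bx * (I i).M ^ 2 * ε + ε)) < δc i)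
    (he1 : ∀ i ε, 0 < ε → ε ≤ eD i → (4 * 1 * (2 * (I i).M ^ 5 * hst * cJ / γ) + bx * (I i).M ^ 2) * ε < a₁ i) :
    B15.Prop1Printed (lfVarOn su2Chart I) := by
  have h1 : 1 < P.d := by omega
  refine prop1Printed_lfVarOn_su2_box_slice_local hd I Rg T H Hst hadj Δ₁ dV J lo hi n hn hN hbox hZ ⟨0, h0⟩ rfl
    (fun i b hb => mem_G0_image h0 (lo i) (hi i) b (hTG0 i ▸ hb)) ext hγ hh₁ hhst hcJ hbx
    hℓ hr heA heD heR hRg hδc ha₁ hM ?_ hH hHst hdV0 hdV hρ hsmall hA hJ hc3 hc3'' hAn hdom hext0 hextZ hextΛ hN' hδ he1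
  -- (m1) from (1.7) + the `x₁`-axial (1.8) at the slice
  intro i Vk hR x
  have hS : pts (I i).k (I i).Λ =
      castSite '' (↑(box (fun κ => (hi i κ - lo i κ + 1).toNat) (lo i)) : Set (Fin P.d → ℤ)) := by
    rw [hbox i, box_toNat_coe]
  have h19 := ineq19_slice_of_17 h0 h1 (hN5 i) (hK1 i) (hKn i ⟨0, h0⟩) (hKn i ⟨1, h1⟩) hS (hTG0 i) (H i Vk) (Δ₁ i Vk)
    hγ₀ (h17 i Vk hR) (hsm i) x
  exact (mul_le_mul_of_nonneg_right (hγle i) (sq_nonneg _)).trans h19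

/-! ## §3 Layer 4: the p. 193 extension pinned (local) -/

/-- **LOCAL twin of `B15Prop1CarrierOnSU2BoxExt193.prop1Printed_lfVarOn_su2_box_G0_of_17_ext193`.**
[cite: Balaban1989LargeFieldI, Prop. 1 (1.77)–(1.78) p.194, p.193; Balaban1989LargeFieldII, (1.7)–(1.9) p.358, pp.358–359; Balaban1985Variational, Prop. 4 p.293] -/
theorem prop1Printed_lfVarOn_su2_box_G0_of_17_ext193_local (hd3 : 3 ≤ P.d) (h0 : 0 < P.d) {ι : Type}
    (I : ι → InstOn P SU2) (Rg : ∀ i, GaugeField P (I i).k SU2 → Prop)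
    [∀ i, DecidableEq (PBond P (I i).k)]
    (T : ∀ i, Finset (PBond P (I i).k))
    {F : ι → Type*} [∀ i, NormedAddCommGroup (F i)] [∀ i, InnerProductSpace ℝ (F i)]
    (H : ∀ i, GaugeField P (I i).k SU2 →
      (GaugeSlice (pts (I i).k (I i).Λ) (T i) (EuclideanSpace ℝ (Fin 3)) →ₗ[ℝ] F i))
    (Hst : ∀ i, GaugeField P (I i).k SU2 →
      (F i →ₗ[ℝ] GaugeSlice (pts (I i).k (I i).Λ) (T i) (EuclideanSpace ℝ (Fin 3))))
    (hadj : ∀ i Vk (x : GaugeSlice (pts (I i).k (I i).Λ) (T i) (EuclideanSpace ℝ (Fin 3))) (y : F i),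
      ⟪H i Vk x, y⟫ = ⟪x, Hst i Vk y⟫)
    (Δ₁ : ∀ i, GaugeField P (I i).k SU2 → (F i →ₗ[ℝ] F i)) (dV : ∀ i, GaugeField P (I i).k SU2 → F i → F i)
    (J : ∀ i, GaugeField P (I i).k SU2 → F i)
    (lo hi : ι → Fin P.d → ℤ) (n : ι → ℕ) (hn : ∀ i κ, hi i κ ≤ lo i κ + n i) (hN : ∀ i, n i + 2 < P.sitesPerDir (I i).k)
    (hbox : ∀ i, pts (I i).k (I i).Λ = (castSite '' Set.Icc (lo i) (hi i) : Set (Site P (I i).k)))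
    (hZ : ∀ i, (boxPlaqs (lo i - 1) (hi i + 1) : Set (Plaq P (I i).k)) ⊆ plaqsInside (pts (I i).k (I i).Z))
    (hTG0 : ∀ i, T i = (box (fun κ => (hi i κ - lo i κ + 1).toNat) (lo i)).image fun x =>
      (⟨castSite (x - unitVec ⟨0, h0⟩), ⟨0, h0⟩⟩ : PBond P (I i).k))
    (hN5 : ∀ i κ, ((hi i κ - lo i κ + 1).toNat : ℤ) + 5 < P.sitesPerDir (I i).k)
    (K : ι → ℕ) (hK1 : ∀ i, 1 ≤ K i) (hKn : ∀ i κ, (hi i κ - lo i κ + 1).toNat ≤ K i)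
    (ext : ∀ i, GaugeField P (I i).k SU2 → GaugeField P (I i).k SU2)
    -- (ℓ2) REPLACED: the extension is r12's p. 193 shell-gauge extension, `Λ` non-degenerate, constant bookkeeping `hbxM`
    (hext : ∀ i Vk, ext i Vk = extend (pts (I i).k (I i).Λ) (shellGauge Vk (lo i) (hi i)) Vk)
    (hlohi : ∀ i, lo i ≤ hi i)
    {γ γ₀ h₁ hst cJ bx : ℝ} (hγ : 0 < γ) (hγ₀ : 0 ≤ γ₀) (hh₁ : 0 ≤ h₁) (hhst : 0 ≤ hst) (hcJ : 0 ≤ cJ) (hbx : 0 ≤ bx)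
    (hbxM : ∀ i, 12 * (P.d : ℝ) * ((n i : ℝ) + 2) ^ 2 ≤ bx * (I i).M ^ 2)
    {ℓ ρ r eA eD a₁ δc Cerr eR : ι → ℝ} (hℓ : ∀ i, 0 ≤ ℓ i) (hr : ∀ i, 0 < r i) (heA : ∀ i, 0 < eA i) (heD : ∀ i, 0 < eD i)
    (heR : ∀ i, 0 < eR i) (hRg : ∀ i ε Vk, 0 < ε → ε ≤ eR i → (lfVarOn su2Chart I).Regular i ε Vk → Rg i Vk)
    (hδc : ∀ i, 0 < δc i) (ha₁ : ∀ i, 0 ≤ a₁ i) (hM : ∀ i, 1 ≤ (I i).M)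
    -- (m1) REPLACED by the (1.7) letter, the smallness and the constant bookkeeping
    (h17 : ∀ i Vk, Rg i Vk → ∀ X : GaugeSlice (pts (I i).k (I i).Λ) (T i) (EuclideanSpace ℝ (Fin 3)),
      γ₀ * (∑ z ∈ box (fun κ => (hi i κ - lo i κ + 1).toNat + 3) (fun κ => lo i κ - 2), ∑ μ : Fin P.d, ∑ a : Fin 3,
          curl (fun b => ιA (pts (I i).k (I i).Λ) (T i) X (⟨castSite b.1, b.2⟩ : PBond P (I i).k) a) z ⟨0, h0⟩ μ ^ 2) -
        Cerr i * ‖X‖ ^ 2 ≤ ⟪H i Vk X, Δ₁ i Vk (H i Vk X)⟫)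
    (hsm : ∀ i, Cerr i ≤ γ₀ / (2 * (3 * (K i : ℝ) ^ 2 + 2 * (K i : ℝ) ^ 4)))
    (hγle : ∀ i, γ / (I i).M ^ 5 ≤ γ₀ / (2 * (3 * (K i : ℝ) ^ 2 + 2 * (K i : ℝ) ^ 4)))
    (hH : ∀ i Vk, Rg i Vk → ∀ x, ‖H i Vk x‖ ≤ h₁ * ‖x‖) (hHst : ∀ i Vk, Rg i Vk → ∀ z, ‖Hst i Vk z‖ ≤ hst * ‖z‖)
    (hdV0 : ∀ i Vk, Rg i Vk → dV i Vk 0 = 0)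
    (hdV : ∀ i Vk, Rg i Vk → ∀ u v : F i, ‖u‖ ≤ ρ i → ‖v‖ ≤ ρ i → ‖dV i Vk u - dV i Vk v‖ ≤ ℓ i * ‖u - v‖)
    (hρ : ∀ i, h₁ * r i ≤ ρ i) (hsmall : ∀ i, (I i).M ^ 5 / γ * hst * ℓ i * h₁ ≤ 1 / 2)
    (hA : ∀ i Vk, Rg i Vk → ∀ X δ : GaugeSlice (pts (I i).k (I i).Λ) (T i) (EuclideanSpace ℝ (Fin 3)), ‖X‖ ≤ r i →
      HasDerivAt (fun s : ℝ => (I i).f (expMul su2Chart (ιA (pts (I i).k (I i).Λ) (T i) (X + s • δ)) (ext i Vk)))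
      (⟪δ, Hst i Vk (J i Vk)⟫ + ⟪δ, Hst i Vk (Δ₁ i Vk (H i Vk X))⟫ + ⟪δ, Hst i Vk (dV i Vk (H i Vk X))⟫) 0)
    (hJ : ∀ i ε Vk, 0 < ε → (lfVarOn su2Chart I).Regular i ε Vk → ‖J i Vk‖ ≤ cJ * ε)
    (hc3 : ∀ i Vk, Rg i Vk → ∀ B : GaugeSlice (pts (I i).k (I i).Λ) (T i) (EuclideanSpace ℝ (Fin 3)), ‖B‖ ≤ r i →
      (IsCriticalPt su2Chart (bondsOf (pts (I i).k (I i).Λ)) (I i).f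
          (expMul su2Chart (ιA (pts (I i).k (I i).Λ) (T i) B) (ext i Vk)) ↔
        ∀ δB : GaugeSlice (pts (I i).k (I i).Λ) (T i) (EuclideanSpace ℝ (Fin 3)),
          ⟪δB, Hst i Vk (J i Vk)⟫ + ⟪δB, Hst i Vk (Δ₁ i Vk (H i Vk B))⟫ + ⟪δB, Hst i Vk (dV i Vk (H i Vk B))⟫ = 0))
    (hc3'' : ∀ i (u : GaugeTransf P (I i).k SU2) (V : GaugeField P (I i).k SU2), IsGaugeOn (pts (I i).k (I i).Λ) u →
      (I i).f (gaugeAct u V) = (I i).f V)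
    (hAn : ∀ i ε Vk, 0 < ε → ε ≤ eA i → (lfVarOn su2Chart I).Regular i ε Vk → (I i).An ε Vk)
    (hdom : ∀ i, (I i).dom = domReg (I i).Z (I i).k (a₁ i))
    -- thresholds (`N i = √|free bonds|`)
    (hN' : ∀ i, Real.sqrt (freeBonds (pts (I i).k (I i).Λ) (T i)).card * (π / 2 * δc i) ≤ r i)
    (hδ : ∀ i ε, 0 < ε → ε ≤ eD i →
      ((n i : ℝ) + 2) * ((n i : ℝ) + P.d) * (a₁ i + (bx * (I i).M ^ 2 * ε + ε)) < δc i)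
    (he1 : ∀ i ε, 0 < ε → ε ≤ eD i → (4 * 1 * (2 * (I i).M ^ 5 * hst * cJ / γ) + bx * (I i).M ^ 2) * ε < a₁ i) :
    B15.Prop1Printed (lfVarOn su2Chart I) := by

  have hd : 2 ≤ P.d := by omega
  have hN3 : ∀ i κ, hi i κ - lo i κ + 3 < (P.sitesPerDir (I i).k : ℤ) := fun i κ => by
    have h5 := hN5 i κ
    have hle : lo i κ ≤ hi i κ := hlohi i κ
    rw [Int.toNat_of_nonneg (by linarith)] at h5
    linarith
  refine prop1Printed_lfVarOn_su2_box_G0_of_17_local hd h0 I Rg T H Hst hadj Δ₁ dV J lo hi n hn hN hbox hZ hTG0 hN5 K hK1 hKn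
    ext hγ hγ₀ hh₁ hhst hcJ hbx hℓ hr heA heD heR hRg hδc ha₁ hM h17 hsm hγle hH hHst hdV0 hdV hρ hsmall hA hJ hc3 hc3'' hAn hdom
    ?_ ?_ ?_ hN' hδ he1
  · -- hext0: *"equal to the given one on Z∩Λ^c"*
    intro i Vk
    rw [hext]
    exact extend_mem_extSet _ _ _
  · -- hextZ: every plaquette of `Z^{(k)}`
    intro i ε Vk hε _ hreg p hp
    rw [hext]
    exact ((dist1_plaqHol_extend_shellGauge_le hd3 (hlohi i) (hn i) (hN3 i) (hbox i) (hZ i) hε hreg).1 p hp).trans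
      (mul_le_mul_of_nonneg_right (hbxM i) hε.le)
  · -- hextΛ: every plaquette meeting `Λ^{(k)}`
    intro i ε Vk hε hreg p hp
    rw [hext]
    exact ((dist1_plaqHol_extend_shellGauge_le hd3 (hlohi i) (hn i) (hN3 i) (hbox i) (hZ i) hε hreg).2 p hp).trans
      (mul_le_mul_of_nonneg_right (hbxM i) hε.le)

end Literature.MathematicalPhysics.QuantumFieldTheory.Balaban1983to89.B15Prop1LocalLettersSU2Box

end
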